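import Summits.Ventures.CertifiedManyBodySolver.Rows.HalfFilledTLCertJoins
import Summits.Ventures.CertifiedManyBodySolver.Rows.HalfFilledTLTorusPinRange
import Literature.MathematicalPhysics.QuantumLattice.InfVolFermionStateBounds
import HarnessLib

/-!
# M2 rows, part 11 — the KINEMATIC range `[-3/4, 1/4]` of `𝐒_x·𝐒_y` in every infinite-volume state

HONEST FRAMING: first certified bounds; not a superconductivity verdict; every number certified or
labelled float.  This file adds NO number of physics: it proves the a-priori (kinematic) range of the
nearest-neighbour spin word that the certificate instances quote in prose ("a-priori range of `spin_nn`
per bond is `[-3/4, +1/4]`", `Certificates/HubbardSquare_n1_corr_spin_nn_U6.lean`), so that a TL `C₁` table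
cell whose LOWER endpoint has no certificate instance can still be written as a two-sided THEOREM row
`[-3/4, hi]` — the floor being labelled KINEMATIC (theorem, certificate-free, physically almost empty),
never "certified".

* §1 (any finite ordered site set `Λ`): `𝐒_x·𝐒_y + 3/4 ⪰ 0` and `1/4 - 𝐒_x·𝐒_y ⪰ 0` for
  `x ≠ y` (two spins-½: triplet `+1/4`, singlet `-3/4`, and `0` off the singly-occupied sector), assembled
  from `Observables.posSemidef_localMoment_add_two_smul_fermionSpinDot` /
  `Observables.posSemidef_quarter_localMoment_sub_fermionSpinDot'` and `m_x ≤ 1` (part 9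
  `posSemidef_one_sub_localMoment`).
* §2 (EVERY `ω : InfVolFermionState d`, no Hubbard input): `-3/4 ≤ Re ω_Λ(𝐒_x·𝐒_y) ≤ 1/4` (`x ≠ y`), by
  state positivity on PSD observables (`InfVolFermionState.expect_re_nonneg_of_posSemidef`).
* §3 (rows): `SpinNNRow U (-3/4) (1/4)` for every `U`; with Shen–Qiu–Tian `SpinNNRow U (-3/4) 0` (`U > 0`);
  the intersection rule `SpinNNRow U lo hi → SpinNNRow U (max lo (-3/4)) (min hi (1/4))`; an UPPER certificate
  row plus a certified energy ceiling give the two-sided cell `SpinNNRow U (-3/4) hi`; and the instance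
  `spinNNRow_U6_of_r95_r21 : cert_r95_… → cert_r21_… → SpinNNRow 6 (-3/4) (-25953429852700721270967/2⁸⁰)`
  (TL_C1_U6: kinematic floor, CERTIFIED ceiling #95 ∧ #21).

Nothing is asserted unconditionally beyond kinematics; the certificate claim nodes stay hypotheses.
-/

noncomputable section

namespace Summit.Ventures.CertifiedManyBodySolver

open Literature.MathematicalPhysics.QuantumLattice
open Matrix HubbardWave0 Literature.Probability.LatticeModels FermionSpinMoment
open scoped ComplexOrder

namespace M2

/-! ## §1 Two-site operator inequalities -/

section TwoSite

variable {Λ : Type*} [LinearOrder Λ] [Fintype Λ]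

/-- **Singlet floor** `𝐒_x·𝐒_y + 3/4 ⪰ 0` (`x ≠ y`): `= ½[(3/4)(m_x+m_y) + 2𝐒_x·𝐒_y] + (3/8)[(1-m_x)+(1-m_y)]`.
[cite: EsslerEtAl2005, §2.2.5 eq. (2.76)] -/
theorem posSemidef_fermionSpinDot_add_three_quarters {x y : Λ} (hxy : x ≠ y) :
    (fermionSpinDot x y + (3 / 4 : ℂ) • (1 : Matrix (Finset (Orb Λ)) (Finset (Orb Λ)) ℂ)).PosSemidef := by
  have half_nonneg : (0 : ℂ) ≤ 1 / 2 := by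
    rw [show (1 / 2 : ℂ) = ((1 / 2 : ℝ) : ℂ) by norm_num]
    exact Complex.zero_le_real.2 (by norm_num)
  have h38 : (0 : ℂ) ≤ 3 / 8 := by
    rw [show (3 / 8 : ℂ) = ((3 / 8 : ℝ) : ℂ) by norm_num]
    exact Complex.zero_le_real.2 (by norm_num)
  have h := ((Observables.posSemidef_localMoment_add_two_smul_fermionSpinDot hxy).smul half_nonneg).add
    (((posSemidef_one_sub_localMoment x).add (posSemidef_one_sub_localMoment y)).smul h38)
  convert h using 1
  module

/-- **Triplet ceiling** `(1/4)·1 - 𝐒_x·𝐒_y ⪰ 0` (`x ≠ y`): `= [(1/4)m_x - 𝐒_x·𝐒_y] + (1/4)(1 - m_x)`.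
[cite: EsslerEtAl2005, §2.2.5 eq. (2.76)] -/
theorem posSemidef_quarter_sub_fermionSpinDot {x y : Λ} (hxy : x ≠ y) :
    ((1 / 4 : ℂ) • (1 : Matrix (Finset (Orb Λ)) (Finset (Orb Λ)) ℂ) - fermionSpinDot x y).PosSemidef := by
  have quarter_nonneg : (0 : ℂ) ≤ 1 / 4 := by
    rw [show (1 / 4 : ℂ) = ((1 / 4 : ℝ) : ℂ) by norm_num]
    exact Complex.zero_le_real.2 (by norm_num)
  have h := (Observables.posSemidef_quarter_localMoment_sub_fermionSpinDot' hxy).add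
    ((posSemidef_one_sub_localMoment x).smul quarter_nonneg)
  convert h using 1
  module

end TwoSite

/-! ## §2 Every infinite-volume state: `-3/4 ≤ Re ω_Λ(𝐒_x·𝐒_y) ≤ 1/4` -/

section State

variable {d : ℕ}

/-- `pt x hx = pt y hy → x = y`. [folklore] -/
theorem PolySite_pt_injective {Λ : Finset (Site d)} {x y : Site d} (hx : x ∈ Λ) (hy : y ∈ Λ)
    (h : PolySite.pt x hx = PolySite.pt y hy) : x = y := by
  simpa using congrArg (fun p : PolySite Λ => ofLex p.1) h

/-- **Kinematic floor**: `-3/4 ≤ Re ω_Λ(𝐒_x·𝐒_y)` for EVERY infinite-volume state `ω` and `x ≠ y`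
(state positivity on `𝐒_x·𝐒_y + 3/4 ⪰ 0`). [cite: BratteliRobinsonI1987, Def. 2.3.9] -/
theorem re_expect_spinDotAt_ge (ω : InfVolFermionState d) {Λ : Finset (Site d)} {x y : Site d}
    (hx : x ∈ Λ) (hy : y ∈ Λ) (hxy : x ≠ y) :
    -(3 / 4 : ℝ) ≤ (ω.expect Λ (spinDotAt x hx y hy)).re := by
  have hne : PolySite.pt x hx ≠ PolySite.pt y hy := fun h => hxy (PolySite_pt_injective hx hy h)
  have h := ω.expect_re_nonneg_of_posSemidef Λ (posSemidef_fermionSpinDot_add_three_quarters hne)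
  rw [map_add, map_smul, ω.expect_one Λ, smul_eq_mul, mul_one, Complex.add_re,
    show (3 / 4 : ℂ) = ((3 / 4 : ℝ) : ℂ) by norm_num, Complex.ofReal_re] at h
  show -(3 / 4 : ℝ) ≤ (ω.expect Λ (fermionSpinDot (PolySite.pt x hx) (PolySite.pt y hy))).re
  linarith

/-- **Kinematic ceiling**: `Re ω_Λ(𝐒_x·𝐒_y) ≤ 1/4` for EVERY infinite-volume state `ω` and `x ≠ y`
(state positivity on `1/4 - 𝐒_x·𝐒_y ⪰ 0`). [cite: BratteliRobinsonI1987, Def. 2.3.9] -/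
theorem re_expect_spinDotAt_le (ω : InfVolFermionState d) {Λ : Finset (Site d)} {x y : Site d}
    (hx : x ∈ Λ) (hy : y ∈ Λ) (hxy : x ≠ y) :
    (ω.expect Λ (spinDotAt x hx y hy)).re ≤ 1 / 4 := by
  have hne : PolySite.pt x hx ≠ PolySite.pt y hy := fun h => hxy (PolySite_pt_injective hx hy h)
  have h := ω.expect_re_nonneg_of_posSemidef Λ (posSemidef_quarter_sub_fermionSpinDot hne)
  rw [map_sub, map_smul, ω.expect_one Λ, smul_eq_mul, mul_one, Complex.sub_re,
    show (1 / 4 : ℂ) = ((1 / 4 : ℝ) : ℂ) by norm_num, Complex.ofReal_re] at h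
  show (ω.expect Λ (fermionSpinDot (PolySite.pt x hx) (PolySite.pt y hy))).re ≤ 1 / 4
  linarith

/-- `0 ≠ e₁` in `ℤ²`. [folklore] -/
theorem zero_ne_unitVec_zero : (0 : Site 2) ≠ unitVec 0 := by
  intro h
  have h' := congrFun h 0
  simp [unitVec] at h'

/-- **The per-bond word**: `-3/4 ≤ Re ω(𝐒_0·𝐒_{e₁}) ≤ 1/4` for EVERY `ω : InfVolFermionState 2` — no
Hubbard input, no certificate. [cite: BratteliRobinsonI1987, Def. 2.3.9] -/
theorem spinNN_mem_Icc (ω : InfVolFermionState 2) :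
    -(3 / 4 : ℝ) ≤ (ω.expect ({0, unitVec 0} : Finset (Site 2)) spinNNObs).re ∧
      (ω.expect ({0, unitVec 0} : Finset (Site 2)) spinNNObs).re ≤ 1 / 4 :=
  ⟨re_expect_spinDotAt_ge ω _ _ zero_ne_unitVec_zero, re_expect_spinDotAt_le ω _ _ zero_ne_unitVec_zero⟩

end State

/-! ## §3 Rows: kinematic endpoints for the `spin_nn` table cells -/

/-- **A-priori row** `SpinNNRow U (-3/4) (1/4)` for every `U` (kinematics only; both endpoints are labelled
KINEMATIC in the table, never "certified"). [cite: BratteliRobinsonI1987, Def. 2.3.9] -/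
theorem spinNNRow_apriori (U : ℝ) : SpinNNRow U (-3 / 4) (1 / 4) := by
  intro ω _
  obtain ⟨hlo, hhi⟩ := spinNN_mem_Icc ω
  constructor
  · push_cast; linarith
  · push_cast; linarith

/-- **Certificate-free row with the Shen–Qiu–Tian sign**: `SpinNNRow U (-3/4) 0`, `U > 0`.
[cite: ShenQiuTian1994, Theorem and eqs. (7)–(9)] -/
theorem spinNNRow_kinematic_sqt {U : ℝ} (hU : 0 < U) : SpinNNRow U (-3 / 4) 0 := by
  intro ω hω
  refine ⟨?_, ?_⟩
  · have := (spinNN_mem_Icc ω).1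
    push_cast
    linarith
  · push_cast
    exact spinNN_nonpos hU hω

/-- **Intersection with the kinematic range**: any `spin_nn` cell may be tightened to
`[max lo (-3/4), min hi (1/4)]`. [cite: BratteliRobinsonI1987, Def. 2.3.9] -/
theorem SpinNNRow.inter_kinematic {U : ℝ} {lo hi : ℚ} (h : SpinNNRow U lo hi) :
    SpinNNRow U (max lo (-3 / 4)) (min hi (1 / 4)) := by
  intro ω hω
  obtain ⟨hlo, hhi⟩ := h ω hω
  obtain ⟨klo, khi⟩ := spinNN_mem_Icc ω
  push_cast
  exact ⟨max_le hlo (by linarith), le_min hhi (by linarith)⟩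

/-- **Two-sided cell from an UPPER certificate alone**: a certificate row `SpinNNUpperRow U u hi` and a
certified energy ceiling `e₀(U) ≤ u` give `SpinNNRow U (-3/4) hi` (floor KINEMATIC, ceiling CERTIFIED).
[cite: WangEtAl2024, §III] -/
theorem SpinNNRow.of_upper_kinematic {U : ℝ} {u hi : ℚ} (hE : M2EnergyUpperRow U u)
    (hu : SpinNNUpperRow U u hi) : SpinNNRow U (-3 / 4) hi := by
  intro ω hω
  refine ⟨?_, squareCorrUpperRow_iff.1 hu ω hω hE⟩
  have := (spinNN_mem_Icc ω).1
  push_cast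
  linarith

/-- **Two-sided cell from a LOWER certificate alone** (twin; ceiling `0` by Shen–Qiu–Tian, `U > 0`):
`SpinNNLowerRow U u lo` and `e₀(U) ≤ u` give `SpinNNRow U lo 0`. [cite: ShenQiuTian1994, Theorem and eqs. (7)–(9)] -/
theorem SpinNNRow.of_lower_sqt {U : ℝ} (hU : 0 < U) {u lo : ℚ} (hE : M2EnergyUpperRow U u)
    (hl : SpinNNLowerRow U u lo) : SpinNNRow U lo 0 := by
  intro ω hω
  refine ⟨squareCorrLowerRow_iff.1 hl ω hω hE, ?_⟩
  push_cast
  exact spinNN_nonpos hU hω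

/-- **The TL_C1_U6 cell as ONE two-sided theorem row**: the claim nodes #95 (`cert_r95_…`, certsdp/1 upper
certificate) and #21 (`cert_r21_…`, LUC TL energy ceiling) give
`SpinNNRow 6 (-3/4) (-25953429852700721270967/2⁸⁰)`: for every `ω ∈ TLGS(6)`,
`-3/4 ≤ Re ω(𝐒_0·𝐒_{e₁}) ≤ -25953429852700721270967/2⁸⁰ ≈ -0.0214681740` — floor KINEMATIC (this file),
ceiling CERTIFIED (`spinNNUpperRow_U6_of_r95`, part 10). [cite: WangEtAl2024, §III] -/
theorem spinNNRow_U6_of_r95_r21 (h : Certificates.cert_r95_sr_hubSQ_w3_U6_R3b4eom_ob3p_Sup)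
    (hE : Certificates.cert_r21_luc_tl_upper_n1_U6) :
    SpinNNRow 6 (-3 / 4) (-25953429852700721270967 / 1208925819614629174706176) :=
  SpinNNRow.of_upper_kinematic (Certificates.m2_U6_upper_r21_of hE) (spinNNUpperRow_U6_of_r95 h)

/-- Bond-averaged twin of `spinNNRow_U6_of_r95_r21` on the typed support `nnSupport` with the word
`spinNNAvgObs = ½(𝐒_0·𝐒_{e₁} + 𝐒_0·𝐒_{e₂})` (part 3 `spinNNAvg_correlatorRow_iff`). [cite: WangEtAl2024, §III] -/
theorem spinNNAvgRow_U6_of_r95_r21 (h : Certificates.cert_r95_sr_hubSQ_w3_U6_R3b4eom_ob3p_Sup)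
    (hE : Certificates.cert_r21_luc_tl_upper_n1_U6) :
    CorrelatorRow 6 Summit.HubbardSuperconductivity.ManyBodyBootstrap.Bounds.nnSupport spinNNAvgObs
      (-3 / 4) (-25953429852700721270967 / 1208925819614629174706176) :=
  (spinNNAvg_correlatorRow_iff (by norm_num)).2 (spinNNRow_U6_of_r95_r21 h hE)

end M2

end Summit.Ventures.CertifiedManyBodySolver
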